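import Literature.AlgebraicGeometry.Motives.MixedHodgeStructureCatWeightGradedObject
import HarnessLib

/-!
# The associated weight-graded MHS, III: `grTotal s` is additive and exact, and `grTotal s ⋙ Gr^W_j ≅ Gr^W_j` naturally

Layer `Literature/AlgebraicGeometry/Motives` (lane `lit-hodgefound`), sequel to g44-#12 (`Motives/MixedHodgeStructureCatWeightGradedObject`: the functor
`grTotal s X = ⨁_{j ∈ s} (ofPure j)(Gr^W_j X)` and the object-wise isomorphisms `grGrTotalObjIso : Gr^W_j((grTotal s) X) ≅ Gr^W_j X`, `j ∈ s`).
Here: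

* §1 `grTotal s` is an ADDITIVE functor (instances `Functor.Additive`, hence `PreservesZeroMorphisms`, on this file's own functor only);
* §2 the isomorphisms `grGrTotalObjIso` are `Gr^W_j(π_j) ≫ (Gr^W_j((ofPure j) Y) ⥲ Y)` (`grGrTotalObjIso_hom`) and therefore NATURAL:
  **`grTotalCompGrIso : grTotal s ⋙ gr j ≅ gr j`** (`j ∈ s`);
* §3 **`grTotal s` is EXACT**: it carries short exact sequences to short exact sequences (`grTotal_map_shortExact`) and exact sequences to exact
  sequences (`grTotal_map_exact`) — checked on graded pieces (g43 `shortExact_iff_forall_gr_map_shortExact`, `exact_iff_forall_gr_map_exact`: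
  a sequence of MHS is (short) exact iff all its `Gr^W_k` are), where `Gr^W_k ∘ grTotal s ≅ Gr^W_k` for `k ∈ s` and `= 0` for `k ∉ s`.

Everything is PROVED; definitions with bodies; no named fact, no notation; `[HasFiniteBiproducts MixedHodgeStructureCat]` is carried as a
hypothesis (the tree's theorem `hasFiniteBiproducts`), as in g44-#12.

Sources, verbatim.  E. Cattani, F. El Zein, P. A. Griffiths, Lê D. T. (eds.), *Hodge Theory* (2014) [CattaniElZeinGriffithsLe2014] (held text
`book:cattani2014-hodge-theory-princeton-mathematical-notes-49`): Cor. 3.2.21 (ii) (p0161 L14) «The functor `Gr^W_n` from the category of MHS to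
the category `A ⊗ ℚ` HS of weight `n` is exact», Remark after it (p0162 L1) «The above result shows that any exact sequence of MHS gives rise to
various exact sequences …», Ex. 3.2.23 (1)–(2) (p0162–p0163).  P. Deligne, *Théorie de Hodge II* [DeligneHodgeII1971], Thm. 2.3.5 (iii)–(iv).

## Main definitions and results

* §1 instances `(grTotal s).Additive`, `grTotal_map_add`, `grTotal_map_zero`.
* §2 `grGrTotalObjIso_hom`, **`grTotalCompGrIso`** (+ `_hom_app` rfl, `_app`).
* §3 (private `shortExact_of_isZero`), **`grTotal_map_shortExact`**, **`grTotal_map_exact`**, `mono_grTotal_map`, `epi_grTotal_map`.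

## References

* [CattaniElZeinGriffithsLe2014] E. Cattani et al. (eds.), Hodge Theory, Princeton Math. Notes 49 (2014), Cor. 3.2.21 (ii) and Remark, Ex. 3.2.23.
* [DeligneHodgeII1971] P. Deligne, Théorie de Hodge II, Publ. Math. IHÉS 40 (1971), Thm. 2.3.5.

## Provenance

Lane `lit-hodgefound` (summit `HodgeConjecture`), seat `lit-hodgefound-p36` (literature-prover, generation 44, row g44-#14).
-/

noncomputable section

open CategoryTheory CategoryTheory.Limits

namespace Literature.AlgebraicGeometry.Motives

universe u

namespace MixedHodgeStructureCat

section

variable [HasFiniteBiproducts MixedHodgeStructureCat.{u}] (s : Finset ℤ)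

/-! ## §1 `grTotal s` is additive -/

/-- `grTotal s` is an additive functor (a finite biproduct of the additive functors `Gr^W_j ⋙ ofPure j`). [cite: CattaniElZeinGriffithsLe2014, Cor. 3.2.21 (ii)] -/
instance grTotal_additive : (grTotal.{u} s).Additive where
  map_add {X Y f g} := by
    show biproduct.map (fun j : s => (ofPure (j : ℤ)).map ((gr (j : ℤ)).map (f + g))) =
      biproduct.map (fun j : s => (ofPure (j : ℤ)).map ((gr (j : ℤ)).map f)) + biproduct.map (fun j : s => (ofPure (j : ℤ)).map ((gr (j : ℤ)).map g))
    apply biproduct.hom_ext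
    intro j
    simp only [biproduct.map_π, Preadditive.add_comp, Functor.map_add, Preadditive.comp_add]

/-- `(grTotal s)(f + g) = (grTotal s) f + (grTotal s) g`. [cite: CattaniElZeinGriffithsLe2014, Cor. 3.2.21 (ii)] -/
theorem grTotal_map_add {X Y : MixedHodgeStructureCat.{u}} (f g : X ⟶ Y) : (grTotal s).map (f + g) = (grTotal s).map f + (grTotal s).map g :=
  (grTotal s).map_add

/-- `(grTotal s) 0 = 0`. [cite: CattaniElZeinGriffithsLe2014, Cor. 3.2.21 (ii)] -/
theorem grTotal_map_zero (X Y : MixedHodgeStructureCat.{u}) : (grTotal s).map (0 : X ⟶ Y) = 0 :=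
  (grTotal s).map_zero X Y

/-! ## §2 `grTotal s ⋙ Gr^W_j ≅ Gr^W_j`, naturally -/

section Gr

/-- The isomorphism `Gr^W_j((grTotal s) X) ≅ Gr^W_j X` of g44-#12 is `Gr^W_j(π_j)` followed by `Gr^W_j((ofPure j) Y) ⥲ Y`.
[cite: CattaniElZeinGriffithsLe2014, Cor. 3.2.21 (ii) and Ex. 3.2.23 (1)] -/
theorem grGrTotalObjIso_hom (j : s) (X : MixedHodgeStructureCat.{u}) :
    (grGrTotalObjIso s j X).hom = (gr (j : ℤ)).map ((grTotalπ s j).app X) ≫ grOfPureHom (j : ℤ) ((gr (j : ℤ)).obj X) :=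
  have h1 : ((gr (j : ℤ)).mapBiproduct (fun i : s => (ofPure (i : ℤ)).obj ((gr (i : ℤ)).obj X))).hom ≫
      biproduct.π (fun i : s => (gr (j : ℤ)).obj ((ofPure (i : ℤ)).obj ((gr (i : ℤ)).obj X))) j = (gr (j : ℤ)).map ((grTotalπ s j).app X) :=
    biproduct.lift_π _ _
  (Category.assoc _ _ _).symm.trans (congrArg (fun t => t ≫ grOfPureHom (j : ℤ) ((gr (j : ℤ)).obj X)) h1)

/-- **`grTotal s ⋙ Gr^W_j ≅ Gr^W_j` for `j ∈ s`, natural in `X`.** [cite: CattaniElZeinGriffithsLe2014, Cor. 3.2.21 (ii) and Ex. 3.2.23 (1)] -/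
def grTotalCompGrIso (j : s) : grTotal.{u} s ⋙ gr (j : ℤ) ≅ gr (j : ℤ) :=
  NatIso.ofComponents (F := grTotal.{u} s ⋙ gr (j : ℤ)) (G := gr (j : ℤ)) (fun X => grGrTotalObjIso s j X) fun {X Y} f => by
    change (gr (j : ℤ)).map ((grTotal s).map f) ≫ (grGrTotalObjIso s j Y).hom = (grGrTotalObjIso s j X).hom ≫ (gr (j : ℤ)).map f
    have h1 : (grTotal s).map f ≫ (grTotalπ s j).app Y = (grTotalπ s j).app X ≫ (ofPure (j : ℤ)).map ((gr (j : ℤ)).map f) :=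
      (grTotalπ s j).naturality f
    have h2 : (gr (j : ℤ)).map ((ofPure (j : ℤ)).map ((gr (j : ℤ)).map f)) ≫ grOfPureHom (j : ℤ) ((gr (j : ℤ)).obj Y) =
        grOfPureHom (j : ℤ) ((gr (j : ℤ)).obj X) ≫ (gr (j : ℤ)).map f :=
      (ofPureCompGrIso (j : ℤ)).hom.naturality ((gr (j : ℤ)).map f)
    rw [grGrTotalObjIso_hom, grGrTotalObjIso_hom, Category.assoc, ← (gr (j : ℤ)).map_comp_assoc, h1]
    erw [(gr (j : ℤ)).map_comp_assoc, h2]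
    rfl

/-- The components of `grTotalCompGrIso` are the `grGrTotalObjIso` of g44-#12 (by `rfl`). [cite: CattaniElZeinGriffithsLe2014, Cor. 3.2.21 (ii)] -/
theorem grTotalCompGrIso_hom_app (j : s) (X : MixedHodgeStructureCat.{u}) : (grTotalCompGrIso s j).hom.app X = (grGrTotalObjIso s j X).hom := rfl

/-- `(grTotalCompGrIso s j).app X = grGrTotalObjIso s j X`. [cite: CattaniElZeinGriffithsLe2014, Cor. 3.2.21 (ii)] -/
theorem grTotalCompGrIso_app (j : s) (X : MixedHodgeStructureCat.{u}) : (grTotalCompGrIso s j).app X = grGrTotalObjIso s j X := rfl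

/-! ## §3 `grTotal s` is exact -/

omit [HasFiniteBiproducts MixedHodgeStructureCat.{u}] s in
/-- A short complex of zero objects is short exact. [folklore] -/
private theorem shortExact_of_isZero {C : Type*} [Category C] [Abelian C] {S : ShortComplex C} (h₁ : IsZero S.X₁) (h₂ : IsZero S.X₂) (h₃ : IsZero S.X₃) :
    S.ShortExact :=
  haveI : Mono S.f := ⟨fun g g' _ => h₁.eq_of_tgt g g'⟩
  haveI : Epi S.g := ⟨fun g g' _ => h₃.eq_of_src g g'⟩
  { exact := ShortComplex.exact_of_isZero_X₂ S h₂ }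

/-- **`grTotal s` preserves short exact sequences.** [cite: CattaniElZeinGriffithsLe2014, Cor. 3.2.21 (ii) and the Remark after it]
[cite: DeligneHodgeII1971, Thm. 2.3.5 (iii)–(iv)] -/
theorem grTotal_map_shortExact {S : ShortComplex MixedHodgeStructureCat.{u}} (hS : S.ShortExact) : (S.map (grTotal s)).ShortExact := by
  rw [shortExact_iff_forall_gr_map_shortExact]
  intro k
  by_cases hk : k ∈ s
  · change (S.map (grTotal s ⋙ gr k)).ShortExact
    rw [ShortComplex.shortExact_iff_of_iso (S.mapNatIso (grTotalCompGrIso s ⟨k, hk⟩))]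
    exact gr_map_shortExact k hS
  · exact shortExact_of_isZero (isZero_gr_obj_grTotal_obj s hk _) (isZero_gr_obj_grTotal_obj s hk _) (isZero_gr_obj_grTotal_obj s hk _)

/-- **`grTotal s` preserves exact sequences.** [cite: CattaniElZeinGriffithsLe2014, Cor. 3.2.21 (ii) and the Remark after it] [cite: DeligneHodgeII1971, Thm. 2.3.5 (iii)] -/
theorem grTotal_map_exact {S : ShortComplex MixedHodgeStructureCat.{u}} (hS : S.Exact) : (S.map (grTotal s)).Exact := by
  rw [exact_iff_forall_gr_map_exact]
  intro k
  by_cases hk : k ∈ s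
  · change (S.map (grTotal s ⋙ gr k)).Exact
    rw [ShortComplex.exact_iff_of_iso (S.mapNatIso (grTotalCompGrIso s ⟨k, hk⟩))]
    exact gr_map_exact k hS
  · exact ShortComplex.exact_of_isZero_X₂ _ (isZero_gr_obj_grTotal_obj s hk _)

/-- `grTotal s` preserves monomorphisms. [cite: CattaniElZeinGriffithsLe2014, Cor. 3.2.21 (ii)] -/
theorem mono_grTotal_map {X Y : MixedHodgeStructureCat.{u}} (f : X ⟶ Y) [Mono f] : Mono ((grTotal s).map f) := by
  rw [mono_iff_forall_mono_gr_map]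
  intro k
  by_cases hk : k ∈ s
  · have e := (grTotalCompGrIso s ⟨k, hk⟩).hom.naturality f
    haveI : Mono ((gr k).map f) := (mono_iff_forall_mono_gr_map f).1 inferInstance k
    haveI : Mono ((grTotalCompGrIso s ⟨k, hk⟩).hom.app X ≫ (gr k).map f) := mono_comp _ _
    change Mono ((grTotal s ⋙ gr k).map f)
    exact mono_of_mono_fac e
  · exact ⟨fun g g' _ => (isZero_gr_obj_grTotal_obj s hk X).eq_of_tgt g g'⟩

/-- `grTotal s` preserves epimorphisms. [cite: CattaniElZeinGriffithsLe2014, Cor. 3.2.21 (ii)] -/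
theorem epi_grTotal_map {X Y : MixedHodgeStructureCat.{u}} (f : X ⟶ Y) [Epi f] : Epi ((grTotal s).map f) := by
  rw [epi_iff_forall_epi_gr_map]
  intro k
  by_cases hk : k ∈ s
  · have e := (grTotalCompGrIso s ⟨k, hk⟩).hom.naturality f
    haveI : Epi ((gr k).map f) := (epi_iff_forall_epi_gr_map f).1 inferInstance k
    haveI : Epi ((grTotalCompGrIso s ⟨k, hk⟩).hom.app X ≫ (gr k).map f) := epi_comp _ _
    have e' : (grTotal s ⋙ gr k).map f =
        ((grTotalCompGrIso s ⟨k, hk⟩).hom.app X ≫ (gr k).map f) ≫ inv ((grTotalCompGrIso s ⟨k, hk⟩).hom.app Y) := by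
      rw [← e, Category.assoc, IsIso.hom_inv_id, Category.comp_id]
    change Epi ((grTotal s ⋙ gr k).map f)
    rw [e']
    exact epi_comp _ _
  · exact ⟨fun g g' _ => (isZero_gr_obj_grTotal_obj s hk Y).eq_of_src g g'⟩

end Gr

end

end MixedHodgeStructureCat

end Literature.AlgebraicGeometry.Motives

end
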